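import Mathlib.LinearAlgebra.Contraction
import Mathlib.LinearAlgebra.Dual.Lemmas
import Mathlib.RingTheory.Finiteness.Projective
import Mathlib.RingTheory.TensorProduct.Basic
import Mathlib.LinearAlgebra.Quotient.Basic
import HarnessLib

/-!
# The kernel functor `B ↦ ker(B ⊗ K⁰ → B ⊗ K¹)` of a two-term complex of finite projective modules is representable
# (Mumford, *Abelian Varieties*, §5 Lemma 1 and Cor. 2)

For a commutative ring `A` and an `A`-linear map `d : K⁰ → K¹` between finite projective `A`-modules, the
functor on `A`-algebras `B ↦ ker(d_B : B ⊗_A K⁰ → B ⊗_A K¹)` is represented by the finite `A`-module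
`Q := (K⁰)^∨ ⧸ im(d^∨)`: there are `B`-linear isomorphisms `η_B : Hom_A(Q, B) ≅ ker(d_B)` natural along
`A`-algebra maps `φ : B → C` (`exists_reprModule_of_perfect_two_term`). This is the length-one case of
Mumford, *Abelian Varieties*, §5 Cor. 2 (the module `Q` with `Hom_A(Q, B) = H⁰(K• ⊗ B)` for a complex `K•`
of finite projectives), through §5 Lemma 1 (`Hom` and `⊗` for finite projective modules); Hartshorne,
III Prop. 12.4 and its proof ((ii) ⇒ (iii): `Q = coker(Ľ^{i+1} → W̌^i)`,
`0 → Hom(Q, M) → Hom(W̌^i, M) → Hom(Ľ^{i+1}, M)`) is the same construction; cf. Görtz–Wedhorn II, Prop. 23.147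
(the cohomology-rank stratification built from the perfect complex `Rf_*𝓕`).

Ingredients, all proved here and stated without auxiliary definitions:
* `dualTensorHom_rTensor_dualMap` — naturality in `M` of Mathlib's `dualTensorHom R M N : M^∨ ⊗ N → Hom(M, N)`;
* **`dualTensorHom_bijective_of_projective`** — `M^∨ ⊗_R N ≅ Hom_R(M, N)` for `M` finite PROJECTIVE
  (Mathlib's `dualTensorHomEquiv` is the finite free case; a finite projective module is a retract of `Rⁿ`,
  Mathlib `Module.Finite.exists_comp_eq_id_of_projective`, and a retract of a bijection is a bijection);
* **`exists_dualHomEquiv`** — projective duality: a `B`-linear isomorphism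
  `θ : B ⊗_A P ≅ Hom_A(P^∨, B)` with `θ(b ⊗ p)(f) = f(p) b`, for `P` finite projective and any `A`-algebra `B`
  (`P ≅ P^∨∨`, Mathlib `Module.evalEquiv`, composed with the previous item for `M = P^∨`); such a `θ`
  is natural in `B` (`dualHom_rTensor`) and carries `d_B` to precomposition with `d^∨`
  (`dualHom_baseChange`, `baseChange_eq_zero_iff_of_dualHom`) — these are stated for ANY maps with the
  defining formula on pure tensors, which determines them;
* the universal property of the quotient `Q` (Mathlib `Submodule.liftQ`, `Submodule.linearMap_qext`).

Mathlib searched (pin): `dualTensorHom`, `dualTensorHomEquiv`/`dualTensorHomEquivOfBasis` (finite free only),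
`Module.evalEquiv` with `Module.instIsReflexiveOfFiniteOfProjective`, `Module.dual_finite`,
`Module.dual_projective`, `Module.Finite.exists_comp_eq_id_of_projective`, `LinearMap.baseChange`,
`LinearMap.rTensor`, `Submodule.liftQ`, `LinearMap.range_mkQ_comp` (used); Mathlib has no representing
module of the kernel functor and no projective version of `dualTensorHomEquiv`.

## References

* D. Mumford, *Abelian Varieties*, TIFR Studies in Mathematics 5, Oxford University Press (1970): §5,
  Lemma 1 (p. 46) and Cor. 2 (p. 47). [MumfordAV1970]
* R. Hartshorne, *Algebraic Geometry*, GTM 52, Springer (1977): III Prop. 12.4 and its proof. [Hartshorne1977]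
* U. Görtz, T. Wedhorn, *Algebraic Geometry II: Cohomology of Schemes*, Springer Spektrum (2023),
  doi:10.1007/978-3-658-43031-3: cf. Prop. 23.147. [GortzWedhorn2023]
-/

set_option autoImplicit false

noncomputable section

universe u

open TensorProduct Module

namespace Literature.Algebra.Module.ReprModuleTwoTermKernel

/-! ### `M^∨ ⊗ N ≅ Hom(M, N)` for `M` finite projective -/

section DualTensorHom

variable {R : Type u} [CommRing R] {M M' N : Type u} [AddCommGroup M] [Module R M] [AddCommGroup M']
  [Module R M'] [AddCommGroup N] [Module R N]

/-- **Naturality of `dualTensorHom` in `M`**: for `u : M → M′`, `θ_M((u^∨ ⊗ 1) x) = θ_{M′}(x) ∘ u`.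
[cite: MumfordAV1970, §5 Lemma 1 (p. 46)] -/
theorem dualTensorHom_rTensor_dualMap (u : M →ₗ[R] M') (x : Dual R M' ⊗[R] N) :
    dualTensorHom R M N (u.dualMap.rTensor N x) = (dualTensorHom R M' N x) ∘ₗ u := by
  induction x using TensorProduct.induction_on with
  | zero => simp
  | tmul f n =>
    ext m
    simp [LinearMap.rTensor_tmul, dualTensorHom_apply]
  | add x y hx hy => rw [map_add, map_add, hx, hy, map_add, LinearMap.add_comp]

/-- **`M^∨ ⊗_R N → Hom_R(M, N)`, `f ⊗ n ↦ (m ↦ f(m) n)`, is bijective for `M` finite projective**: a finite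
projective `M` is a retract of `Rⁿ`, for which Mathlib's `dualTensorHomEquiv` is the statement, and a
retract of a bijection is a bijection (Mumford §5 Lemma 1: `Hom` and `⊗` commute for finite projective
modules). [cite: MumfordAV1970, §5 Lemma 1 (p. 46)] -/
theorem dualTensorHom_bijective_of_projective [Module.Finite R M] [Projective R M] :
    Function.Bijective (dualTensorHom R M N) := by
  obtain ⟨n, s, g, -, -, hsg⟩ := Module.Finite.exists_comp_eq_id_of_projective R M
  -- the finite free case
  have hF : Function.Bijective (dualTensorHom R (Fin n → R) N) := by
    have h : ⇑(dualTensorHom R (Fin n → R) N) =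
        ⇑(dualTensorHomEquivOfBasis (N := N) (Module.Free.chooseBasis R (Fin n → R))) :=
      funext fun x => (dualTensorHomEquivOfBasis_apply _ x).symm
    rw [h]
    exact LinearEquiv.bijective _
  -- `g^∨ ∘ s^∨ = (s ∘ g)^∨ = 1`
  have hret : ∀ x : Dual R M ⊗[R] N, g.dualMap.rTensor N (s.dualMap.rTensor N x) = x := fun x => by
    rw [← LinearMap.comp_apply, ← LinearMap.rTensor_comp, LinearMap.dualMap_comp_dualMap, hsg,
      LinearMap.dualMap_id, LinearMap.rTensor_id, LinearMap.id_apply]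
  constructor
  · intro x y hxy
    have h' : s.dualMap.rTensor N x = s.dualMap.rTensor N y := hF.1 (by
      rw [dualTensorHom_rTensor_dualMap, dualTensorHom_rTensor_dualMap, hxy])
    rw [← hret x, ← hret y, h']
  · intro y
    obtain ⟨z, hz⟩ := hF.2 (y ∘ₗ s)
    refine ⟨g.dualMap.rTensor N z, ?_⟩
    rw [dualTensorHom_rTensor_dualMap, hz, LinearMap.comp_assoc, hsg, LinearMap.comp_id]

end DualTensorHom

/-! ### Projective duality `B ⊗_A P ≅ Hom_A(P^∨, B)` -/

section DualHom

variable {A : Type u} [CommRing A] {P : Type u} [AddCommGroup P] [Module A P]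
  {B : Type u} [CommRing B] [Algebra A B]

/-- Any additive `θ : B ⊗_A P → Hom_A(P^∨, B)` with `θ(b ⊗ p)(f) = f(p) b` is `B`-linear for the left
`B`-structure on `B ⊗_A P` and post-multiplication on `Hom_A(P^∨, B)`. [cite: MumfordAV1970, §5 Lemma 1 (p. 46)] -/
theorem dualHom_smul (θ : B ⊗[A] P →ₗ[A] (Dual A P →ₗ[A] B))
    (hθ : ∀ (b : B) (p : P) (f : Dual A P), θ (b ⊗ₜ p) f = f p • b) (b : B) (x : B ⊗[A] P) :
    θ (b • x) = b • θ x := by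
  induction x using TensorProduct.induction_on with
  | zero => simp
  | tmul b' p =>
    ext f
    rw [TensorProduct.smul_tmul', hθ, LinearMap.smul_apply, hθ]
    simp only [smul_eq_mul, Algebra.smul_def]
    ring
  | add x y hx hy => rw [smul_add, map_add, map_add, hx, hy, smul_add]

variable (A P B) in
/-- **Projective duality** (Mumford §5 Lemma 1): for `P` finite projective over `A` and any `A`-algebra `B`
there is a `B`-linear isomorphism `θ : B ⊗_A P ≅ Hom_A(P^∨, B)` with `θ(b ⊗ p)(f) = f(p) b`
(`P ≅ P^∨∨` and `P^∨∨ ⊗ B ≅ Hom(P^∨, B)` as `P^∨` is finite projective). [cite: MumfordAV1970, §5 Lemma 1 (p. 46)] -/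
theorem exists_dualHomEquiv [Module.Finite A P] [Projective A P] :
    ∃ θ : B ⊗[A] P ≃ₗ[B] (Dual A P →ₗ[A] B), ∀ (b : B) (p : P) (f : Dual A P), θ (b ⊗ₜ p) f = f p • b := by
  -- the `A`-linear map `dualTensorHom ∘ (eval ⊗ 1) ∘ comm`
  let θ₀ : B ⊗[A] P →ₗ[A] (Dual A P →ₗ[A] B) :=
    dualTensorHom A (Dual A P) B ∘ₗ
      (TensorProduct.congr (evalEquiv A P) (LinearEquiv.refl A B)).toLinearMap ∘ₗ
        (TensorProduct.comm A B P).toLinearMap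
  have hθ₀ : ∀ (b : B) (p : P) (f : Dual A P), θ₀ (b ⊗ₜ p) f = f p • b := fun b p f => by
    simp [θ₀, dualTensorHom_apply]
  have hbij : Function.Bijective θ₀ :=
    (dualTensorHom_bijective_of_projective (R := A) (M := Dual A P) (N := B)).comp
      ((TensorProduct.congr (evalEquiv A P) (LinearEquiv.refl A B)).bijective.comp
        (TensorProduct.comm A B P).bijective)
  exact ⟨LinearEquiv.ofBijective
      { toFun := θ₀
        map_add' := fun x y => map_add _ x y
        map_smul' := fun b x => dualHom_smul θ₀ hθ₀ b x } hbij, hθ₀⟩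

/-- **Naturality in `B`** of maps with the defining formula: `θ_C((φ ⊗ 1) x) = φ ∘ θ_B(x)` for an `A`-algebra
map `φ : B → C`. [cite: MumfordAV1970, §5 Lemma 1 (p. 46)] -/
theorem dualHom_rTensor {C : Type u} [CommRing C] [Algebra A C]
    (θB : B ⊗[A] P ≃ₗ[B] (Dual A P →ₗ[A] B))
    (hθB : ∀ (b : B) (p : P) (f : Dual A P), θB (b ⊗ₜ p) f = f p • b)
    (θC : C ⊗[A] P ≃ₗ[C] (Dual A P →ₗ[A] C))
    (hθC : ∀ (c : C) (p : P) (f : Dual A P), θC (c ⊗ₜ p) f = f p • c)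
    (φ : B →ₐ[A] C) (x : B ⊗[A] P) :
    θC (φ.toLinearMap.rTensor P x) = (φ.toLinearMap.restrictScalars A) ∘ₗ θB x := by
  induction x using TensorProduct.induction_on with
  | zero => simp
  | tmul b p =>
    ext f
    rw [LinearMap.rTensor_tmul, hθC, LinearMap.comp_apply, hθB]
    simp
  | add x y hx hy => rw [map_add, map_add, hx, hy, map_add, LinearMap.comp_add]

/-- **Naturality in `P`**: `θ_{P′}(d_B x) = θ_P(x) ∘ d^∨` for `d : P → P′` and maps with the defining formula.
[cite: MumfordAV1970, §5 Lemma 1 (p. 46)] -/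
theorem dualHom_baseChange {P' : Type u} [AddCommGroup P'] [Module A P']
    (θ : B ⊗[A] P ≃ₗ[B] (Dual A P →ₗ[A] B))
    (hθ : ∀ (b : B) (p : P) (f : Dual A P), θ (b ⊗ₜ p) f = f p • b)
    (θ' : B ⊗[A] P' ≃ₗ[B] (Dual A P' →ₗ[A] B))
    (hθ' : ∀ (b : B) (p : P') (f : Dual A P'), θ' (b ⊗ₜ p) f = f p • b)
    (d : P →ₗ[A] P') (x : B ⊗[A] P) :
    θ' (d.baseChange B x) = θ x ∘ₗ d.dualMap := by
  induction x using TensorProduct.induction_on with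
  | zero => simp
  | tmul b p =>
    ext g
    rw [LinearMap.baseChange_tmul, hθ', LinearMap.comp_apply, LinearMap.dualMap_apply', hθ,
      LinearMap.comp_apply]
  | add x y hx hy => rw [map_add, map_add, hx, hy, map_add, LinearMap.add_comp]

/-- **`d_B x = 0 ↔ θ(x) ∘ d^∨ = 0`**: under projective duality the kernel of `d_B` is the space of
`ψ : (K⁰)^∨ → B` vanishing on `im(d^∨)`. [cite: MumfordAV1970, §5 Cor. 2 (p. 47)] -/
theorem baseChange_eq_zero_iff_of_dualHom {P' : Type u} [AddCommGroup P'] [Module A P']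
    (θ : B ⊗[A] P ≃ₗ[B] (Dual A P →ₗ[A] B))
    (hθ : ∀ (b : B) (p : P) (f : Dual A P), θ (b ⊗ₜ p) f = f p • b)
    (θ' : B ⊗[A] P' ≃ₗ[B] (Dual A P' →ₗ[A] B))
    (hθ' : ∀ (b : B) (p : P') (f : Dual A P'), θ' (b ⊗ₜ p) f = f p • b)
    (d : P →ₗ[A] P') (x : B ⊗[A] P) :
    d.baseChange B x = 0 ↔ θ x ∘ₗ d.dualMap = 0 := by
  rw [← dualHom_baseChange θ hθ θ' hθ' d, ← map_zero θ']
  exact ⟨fun h => by rw [h], fun h => θ'.injective h⟩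

end DualHom

/-! ### The representing module `Q = (K⁰)^∨ ⧸ im(d^∨)` -/

section Repr

variable {A : Type u} [CommRing A] {K0 K1 : Type u} [AddCommGroup K0] [Module A K0] [Module.Finite A K0]
  [Projective A K0] [AddCommGroup K1] [Module A K1] [Module.Finite A K1] [Projective A K1]

omit [Module.Finite A K0] [Projective A K0] [Module.Finite A K1] [Projective A K1] in
/-- **`η_B : Hom_A(Q, B) ≅ ker(d_B)` for `Q = (K⁰)^∨ ⧸ im(d^∨)`, from a projective duality `θ` on `K⁰` and
`θ′` on `K¹`**: `ℓ ↦ θ⁻¹(ℓ ∘ π)`, with inverse `x ↦ (θ x) mod im(d^∨)`; `B`-linear, and with underlying tensor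
`θ⁻¹(ℓ ∘ π)` (no finiteness or projectivity needed once `θ`, `θ′` are given).
[cite: MumfordAV1970, §5 Cor. 2 (p. 47)] -/
theorem exists_kerEquiv_of_dualHom (d : K0 →ₗ[A] K1) (B : Type u) [CommRing B] [Algebra A B]
    (θ : B ⊗[A] K0 ≃ₗ[B] (Dual A K0 →ₗ[A] B))
    (hθ : ∀ (b : B) (p : K0) (f : Dual A K0), θ (b ⊗ₜ p) f = f p • b)
    (θ' : B ⊗[A] K1 ≃ₗ[B] (Dual A K1 →ₗ[A] B))
    (hθ' : ∀ (b : B) (p : K1) (f : Dual A K1), θ' (b ⊗ₜ p) f = f p • b) :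
    ∃ η : ((Dual A K0 ⧸ LinearMap.range d.dualMap) →ₗ[A] B) ≃ₗ[B] LinearMap.ker (d.baseChange B),
      ∀ ℓ, ((η ℓ : LinearMap.ker (d.baseChange B)) : B ⊗[A] K0) =
        θ.symm (ℓ ∘ₗ (LinearMap.range d.dualMap).mkQ) := by
  refine ⟨{ toFun := fun ℓ => ⟨θ.symm (ℓ ∘ₗ (LinearMap.range d.dualMap).mkQ), ?_⟩
            invFun := fun x => (LinearMap.range d.dualMap).liftQ (θ (x : B ⊗[A] K0))
              (LinearMap.range_le_ker_iff.2 ((baseChange_eq_zero_iff_of_dualHom θ hθ θ' hθ' d _).1 x.2))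
            map_add' := fun ℓ ℓ' => ?_
            map_smul' := fun b ℓ => ?_
            left_inv := fun ℓ => ?_
            right_inv := fun x => ?_ }, fun ℓ => rfl⟩
  · rw [LinearMap.mem_ker, baseChange_eq_zero_iff_of_dualHom θ hθ θ' hθ' d, LinearEquiv.apply_symm_apply,
      LinearMap.comp_assoc, LinearMap.range_mkQ_comp, LinearMap.comp_zero]
  · apply Subtype.ext
    simp only [LinearMap.add_comp, map_add, Submodule.coe_add]
  · apply Subtype.ext
    simp only [LinearMap.smul_comp, map_smul, RingHom.id_apply, SetLike.val_smul]
  · apply Submodule.linearMap_qext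
    rw [Submodule.liftQ_mkQ, LinearEquiv.apply_symm_apply]
  · apply Subtype.ext
    change θ.symm _ = _
    rw [Submodule.liftQ_mkQ, LinearEquiv.symm_apply_apply]

/-- **Mumford, *Abelian Varieties* §5 Cor. 2 (length one): the kernel functor of a two-term complex of finite
projective modules is representable.** For an `A`-linear `d : K⁰ → K¹` between finite projective modules there
is a finite `A`-module `Q` (namely `(K⁰)^∨ ⧸ im(d^∨)`) with `B`-linear isomorphisms `η_B : Hom_A(Q, B) ≅ ker(d_B)`
for all `A`-algebras `B`, natural along `A`-algebra maps `φ : B → C`: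
`η_C(φ ∘ ℓ) = (φ ⊗ 1)(η_B ℓ)`. [cite: MumfordAV1970, §5 Cor. 2 (p. 47)]
[cite: Hartshorne1977, III Prop. 12.4 (proof of (ii) ⇒ (iii))] -/
theorem exists_reprModule_of_perfect_two_term (d : K0 →ₗ[A] K1) :
    ∃ (Q : Type u) (_ : AddCommGroup Q) (_ : Module A Q) (_ : Module.Finite A Q),
      ∃ η : ∀ (B : Type u) [CommRing B] [Algebra A B], (Q →ₗ[A] B) ≃ₗ[B] LinearMap.ker (d.baseChange B),
        ∀ (B C : Type u) [CommRing B] [Algebra A B] [CommRing C] [Algebra A C] (φ : B →ₐ[A] C) (ℓ : Q →ₗ[A] B),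
          ((η C ((φ.toLinearMap.restrictScalars A).comp ℓ) : C ⊗[A] K0)) =
            φ.toLinearMap.rTensor K0 ((η B ℓ) : B ⊗[A] K0) := by
  -- choose projective dualities on `K⁰`, `K¹` over every `A`-algebra, then the kernel isomorphisms
  have hθ := fun (B : Type u) [CommRing B] [Algebra A B] => exists_dualHomEquiv A K0 B
  have hθ' := fun (B : Type u) [CommRing B] [Algebra A B] => exists_dualHomEquiv A K1 B
  choose θ hθ using hθ
  choose θ' hθ' using hθ'
  have hη := fun (B : Type u) [CommRing B] [Algebra A B] =>
    exists_kerEquiv_of_dualHom d B (θ B) (hθ B) (θ' B) (hθ' B)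
  choose η hη using hη
  refine ⟨Dual A K0 ⧸ LinearMap.range d.dualMap, inferInstance, inferInstance, inferInstance,
    fun B _ _ => η B, fun B C _ _ _ _ φ ℓ => ?_⟩
  rw [hη, hη]
  apply (θ C).injective
  rw [LinearEquiv.apply_symm_apply, dualHom_rTensor (θ B) (hθ B) (θ C) (hθ C) φ,
    LinearEquiv.apply_symm_apply, LinearMap.comp_assoc]

end Repr

end Literature.Algebra.Module.ReprModuleTwoTermKernel

end
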